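import Summits.KontsevichZagierPeriods.KontsevichZagierPeriods.Theses.TerasomaMultiplication
import Summits.KontsevichZagierPeriods.KontsevichZagierPeriods.Theses.LowDimension
import Summits.KontsevichZagierPeriods.KontsevichZagierPeriods.Theses.DessinsDimensionOne
import Summits.KontsevichZagierPeriods.KontsevichZagierPeriods.Theorems.CompleteModGammaSector.Negative.LoadBearing
import Literature.NumberTheory.Transcendental.KZKernelConjectureForms
import Literature.NumberTheory.Transcendental.KZLogCalculusProofs
import Literature.NumberTheory.Transcendental.KZCalculusProofs

/-!
# `CompleteModGammaSector` (stmt-KontsevichZagierPeriods-14233), line `line-wolfart-collapses-to-huber-wustholz`: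
# stub `stub_eulerBetaTransfer` — what the single-Beta Wolfart sector hinges on

Support file (`--supports`) for the registered stub `stub_eulerBetaTransfer`
(`EulerIntegralSingleBetaTransfer` of the card `Cruxes/CompleteModGammaSector/Ideas/wolfart-collapses-to-huber-wustholz.md`):
for rational `a, b, c, x, y` with `a, b, c − a, c − b ∉ ℤ`, `0 < b < c`, `a + b ≤ c`, `x, y > 0` non-integers, real
algebraic `λ ∈ (0,1)`, `α`, `β`, an Euler representation `r = [(0,1), α t^{b−1}(1−t)^{c−b−1}(1−λt)^{−a}]` and a Beta
representation `ρ = [(0,1), β t^{x−1}(1−t)^{y−1}]` with `r.value = ρ.value` are KZ-equivalent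
(`KZ.of r − KZ.of ρ ∈ KZ.relations`, NOT modulo the Γ-sector).

**Status: blocked, summit-implied, not refutable short of `¬ KontsevichZagierPeriods`.** On paper the stub is
(i) a transcendence theorem read as a structure provider (Wolfart 1988, Satz 1–2, via Wüstholz's analytic subgroup
theorem; Huber–Wüstholz 2022, Thm. 13.3 (2): value equality ⇒ the relation is induced by functoriality of 1-motives,
here an isogeny of the hypergeometric Prym onto a Fermat factor) followed by (ii) the TRANSFER of that curve
correspondence into a chain of moves. Both representations are one-dimensional with `ℚ`-semialgebraic integrands, so
the pair is an instance of the one-dimensional transfer engine filed at summit level, and this file proves exactly that,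
sorry-free, with the registered signature written out verbatim after the hypotheses:

* `stub_eulerBetaTransfer_of` — from the two OPEN items of route `LowDimension` that constitute the Huber–Wüstholz line:
  `LowdimHuberWustholzTransfer` (stmt-KontsevichZagierPeriods-0117: planar areas ⇒ every value equality between
  one-dimensional representations is a KZ-equivalence) and its inlined antecedent `PlanarAreas`
  (stmt-KontsevichZagierPeriods-4990);
* `stub_eulerBetaTransfer_of_dimLeOneBudgetTwo` — from the single OPEN item `DessinsDimensionOne.DimLeOneBudgetTwo`
  (stmt-KontsevichZagierPeriods-6261: Conjecture 1 in dimension `≤ 1` with excursion budget `2`), by monotonicity of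
  `AddSubgroup.closure`;
* `stub_eulerBetaTransfer_of_summit` — from the summit `KontsevichZagierPeriods` (through
  `kzPeriodConjecture'_iff_isRational`: algebraic integrands reduce to rational ones inside the rules), so no kernel-checked
  refutation of the stub exists short of a refutation of Conjecture 1 as formalised;
* `stub_eulerBetaTransfer_degenerate` — the edge `α = 0 ∨ β = 0` is TRUE unconditionally (not a misstatement): both
  integrands are positive multiples of their coefficient on `(0,1)`, so value equality forces `α = β = 0`
  (`coeff_eq_zero_of_value_eq_zero`, positivity of the set integral of a positive integrable function over the open unit
  interval), and a representation whose integrand vanishes on its domain is a relation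
  (`KZ.of_mem_relations_of_eqOn_zero`).

The sector is not vacuous away from that edge: e.g. `(a, b, c) = (1/12, 5/12, 1/2)`, `λ = 1323/1331`, `α = 1`,
`(x, y) = (5/12, 1/12)`, `β = (3/4)·11^{1/4}` (Beukers–Wolfart's algebraic value `₂F₁(1/12, 5/12; 1/2; 1323/1331) =
(3/4)·11^{1/4}`, times `B(5/12, 1/12)` on both sides) satisfies every hypothesis, and both representations exist
(integrability: `b, c − b, x, y > 0`, `(1 − λt)^{−a}` bounded on `(0,1)`; semialgebraicity of the integrands:
`isSemialgebraicFunOn_eulerIntegrand` of the landed stub-1 file).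

Search notes (what was looked for before settling on "blocked"; `lean search --decl`, 2026-08-16):
`Wolfart|WolfartWustholz` — no declaration in `Literature/` (bib keys `Wolfart1988`, `WolfartWustholz1985` only);
`analyticSubgroup` — only the `G_a × G_m × E` instances (`AnalyticSubgroupElliptic.lean`, elliptic logarithms), no abelian
varieties of dimension `> 1`, hence nothing covering hypergeometric Pryms; `HuberWustholz` — the cite-only facts
`HuberWustholzCurvePeriods` (Thm. 13.3 (2) on period symbols), `HuberWustholzOnePeriods`, `…TwoCurve/ManyCurvePeriods`
(elliptic); the transfer items `SymplecticScissors.CurvePeriodsTransfer` / `RealOnePeriodRelations` conclude in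
`closure (1a ∪ 1b ∪ 2 ∪ Green)`, whose Green generator is not known to lie in `KZ.relations` (no `greenSet ⊆ relations`
theorem in the tree), so they do not reach `KZ.Equivalent`; `MultivaluedCoV.SheetTransfer` (stmt-2877) and
`IsogenyCertificates.XMapPeriodTransfer` need the explicit correspondence (sheets / x-maps), which the ∃-output of the
transcendence step does not provide formally; `FermatIsogeny.BetaLinearSector` covers Beta-vs-Beta pairs only;
`KZ.exists_isRational_equivalent_holds` (proved) raises the dimension to `2`, so the `d ≤ 1` RATIONAL layer
`LowdimBaker0DimLeOne` (open; its transcendence input `baker_holds` is proved) does not apply either. The items whose conclusion IS `KZ.Equivalent` for arbitrary one-dimensional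
pairs are exactly `LowDimension.LowdimHuberWustholzTransfer` (+ `PlanarAreas`; duplicated as
`AbelContraction.AreasToArcs`) and `DessinsDimensionOne.DimLeOneBudgetTwo` — all open, all summit-implied.

References: J. Wolfart, *Werte hypergeometrischer Funktionen*, Invent. Math. 92 (1988), Satz 1–2;
A. Huber, G. Wüstholz, *Transcendence and linear relations of 1-periods* (2022), Thm. 13.3;
M. Kontsevich, D. Zagier, *Periods* (2001), §1.2 Conjecture 1.
-/

noncomputable section

-- `Summit.KontsevichZagierPeriods.KontsevichZagierPeriods.…` is the tree's mandated layout (single-conjunct summit).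
set_option linter.dupNamespace false

namespace Summit.KontsevichZagierPeriods.KontsevichZagierPeriods.CompleteModGammaSectorLine

open MeasureTheory Set
open Literature.NumberTheory.Transcendental
open Literature.NumberTheory.Transcendental.KZ

/-! ## The stub over the one-dimensional transfer engine (conditional, sorry-free) -/

/-- **`stub_eulerBetaTransfer` over the Huber–Wüstholz line.** Assuming the two open items of route
`LowDimension` that make up the one-dimensional transfer engine —
`LowdimHuberWustholzTransfer` (stmt-0117: planar areas ⇒ any two one-dimensional representations of
equal value are KZ-equivalent) and its antecedent `PlanarAreas` (stmt-4990) — the single-Beta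
Wolfart sector follows: the Euler representation `[(0,1), α t^{b−1}(1−t)^{c−b−1}(1−λt)^{−a}]` and the
Beta representation `[(0,1), β t^{x−1}(1−t)^{y−1}]` are one-dimensional, so value equality is all
that is used (the registered signature is reproduced verbatim after the two hypotheses; on paper the
value equality is converted into an isogeny by Wolfart's theorem, an instance of Huber–Wüstholz
Thm. 13.3, and the isogeny is what the engine transfers).
[cite: HuberWustholz2022, Thm. 13.3] -/
theorem stub_eulerBetaTransfer_of :
    Summit.KontsevichZagierPeriods.KontsevichZagierPeriods.Theses.LowDimension.LowdimHuberWustholzTransfer →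
    Summit.KontsevichZagierPeriods.KontsevichZagierPeriods.Theses.LowDimension.PlanarAreas →
    ∀ (a b c x y : ℚ) (lam α β : ℝ), Int.fract a ≠ 0 → Int.fract b ≠ 0 → Int.fract (c - a) ≠ 0 →
      Int.fract (c - b) ≠ 0 → 0 < b → b < c → a + b ≤ c → 0 < x → 0 < y → Int.fract x ≠ 0 →
      Int.fract y ≠ 0 → 0 < lam → lam < 1 → IsAlgebraic ℚ lam → IsAlgebraic ℚ α → IsAlgebraic ℚ β →
      ∀ (r ρ : IntegralRep 1), r.domain = {t | t 0 ∈ Set.Ioo (0:ℝ) 1} →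
      Set.EqOn r.integrand (fun t => α * (t 0) ^ ((b : ℝ) - 1) * (1 - t 0) ^ ((c : ℝ) - (b : ℝ) - 1) *
        (1 - lam * t 0) ^ (-(a : ℝ))) r.domain →
      ρ.domain = {t | t 0 ∈ Set.Ioo (0:ℝ) 1} →
      Set.EqOn ρ.integrand (fun t => β * (t 0) ^ ((x : ℝ) - 1) * (1 - t 0) ^ ((y : ℝ) - 1)) ρ.domain →
      r.value = ρ.value → Equivalent r ρ := by
  intro hT hPA a b c x y lam α β _ _ _ _ _ _ _ _ _ _ _ _ _ _ _ _ r ρ _ _ _ _ hv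
  exact hT hPA r ρ hv

/-- **`stub_eulerBetaTransfer` over the excursion-budget item.** Assuming the single open item
`DessinsDimensionOne.DimLeOneBudgetTwo` (Conjecture 1 for representations of dimension `≤ 1`, the
chain passing through representations of dimension `≤ 2` only), the single-Beta Wolfart sector
follows: the budgeted subgroup `closure (moves ∩ closure{dim ≤ 2})` lies in `KZ.relations =
closure (moves)` by monotonicity of `AddSubgroup.closure`. [cite: KontsevichZagier2001, §1.2 Conjecture 1] -/
theorem stub_eulerBetaTransfer_of_dimLeOneBudgetTwo :
    Summit.KontsevichZagierPeriods.KontsevichZagierPeriods.Theses.DessinsDimensionOne.DimLeOneBudgetTwo →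
    ∀ (a b c x y : ℚ) (lam α β : ℝ), Int.fract a ≠ 0 → Int.fract b ≠ 0 → Int.fract (c - a) ≠ 0 →
      Int.fract (c - b) ≠ 0 → 0 < b → b < c → a + b ≤ c → 0 < x → 0 < y → Int.fract x ≠ 0 →
      Int.fract y ≠ 0 → 0 < lam → lam < 1 → IsAlgebraic ℚ lam → IsAlgebraic ℚ α → IsAlgebraic ℚ β →
      ∀ (r ρ : IntegralRep 1), r.domain = {t | t 0 ∈ Set.Ioo (0:ℝ) 1} →
      Set.EqOn r.integrand (fun t => α * (t 0) ^ ((b : ℝ) - 1) * (1 - t 0) ^ ((c : ℝ) - (b : ℝ) - 1) *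
        (1 - lam * t 0) ^ (-(a : ℝ))) r.domain →
      ρ.domain = {t | t 0 ∈ Set.Ioo (0:ℝ) 1} →
      Set.EqOn ρ.integrand (fun t => β * (t 0) ^ ((x : ℝ) - 1) * (1 - t 0) ^ ((y : ℝ) - 1)) ρ.domain →
      r.value = ρ.value → Equivalent r ρ := by
  intro hD a b c x y lam α β _ _ _ _ _ _ _ _ _ _ _ _ _ _ _ _ r ρ _ _ _ _ hv
  have h := hD le_rfl le_rfl r ρ hv
  show of r - of ρ ∈ relations
  unfold relations
  exact AddSubgroup.closure_mono Set.inter_subset_left h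

/-- **`stub_eulerBetaTransfer` is summit-implied.** Conjecture 1 as formalised
(`KontsevichZagierPeriods`, KZ-literal rational shape) gives the stub through
`kzPeriodConjecture'_iff_isRational` (every representation is equivalent inside the rules to a
rational-shape one, `KZ.exists_isRational_equivalent_holds`, and equivalent representations have
equal values). Hence any kernel-checked refutation of the stub refutes the summit.
[cite: KontsevichZagier2001, §1.2 Conjecture 1] -/
theorem stub_eulerBetaTransfer_of_summit :
    _root_.KontsevichZagierPeriods →
    ∀ (a b c x y : ℚ) (lam α β : ℝ), Int.fract a ≠ 0 → Int.fract b ≠ 0 → Int.fract (c - a) ≠ 0 →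
      Int.fract (c - b) ≠ 0 → 0 < b → b < c → a + b ≤ c → 0 < x → 0 < y → Int.fract x ≠ 0 →
      Int.fract y ≠ 0 → 0 < lam → lam < 1 → IsAlgebraic ℚ lam → IsAlgebraic ℚ α → IsAlgebraic ℚ β →
      ∀ (r ρ : IntegralRep 1), r.domain = {t | t 0 ∈ Set.Ioo (0:ℝ) 1} →
      Set.EqOn r.integrand (fun t => α * (t 0) ^ ((b : ℝ) - 1) * (1 - t 0) ^ ((c : ℝ) - (b : ℝ) - 1) *
        (1 - lam * t 0) ^ (-(a : ℝ))) r.domain →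
      ρ.domain = {t | t 0 ∈ Set.Ioo (0:ℝ) 1} →
      Set.EqOn ρ.integrand (fun t => β * (t 0) ^ ((x : ℝ) - 1) * (1 - t 0) ^ ((y : ℝ) - 1)) ρ.domain →
      r.value = ρ.value → Equivalent r ρ := by
  intro hS a b c x y lam α β _ _ _ _ _ _ _ _ _ _ _ _ _ _ _ _ r ρ _ _ _ _ hv
  exact kzPeriodConjecture'_iff_isRational.mpr hS r ρ hv

/-! ## The degenerate edge `α = 0 ∨ β = 0` (unconditional) -/

/-- The value of a representation whose integrand vanishes on its domain is `0`. [folklore] -/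
theorem value_eq_zero_of_eqOn_zero {n : ℕ} {r : IntegralRep n} (h : EqOn r.integrand 0 r.domain) :
    r.value = 0 := by
  unfold IntegralRep.value
  rw [setIntegral_congr_fun (IntegralRep.measurableSet_domain_holds r) h]
  simp

/-- **Positivity transfer.** If a one-dimensional representation pinned to the open unit interval
has integrand `κ · g` on its domain with `g > 0` there, and value `0`, then `κ = 0`: otherwise `g`
is integrable on the domain (it is `κ⁻¹ ·` the integrand), its set integral is positive (positive
integrand on an open set of positive Lebesgue measure,
`MeasureTheory.setIntegral_pos_iff_support_of_nonneg_ae`), and `value = κ · ∫ g ≠ 0`. [folklore] -/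
theorem coeff_eq_zero_of_value_eq_zero {r : IntegralRep 1} {κ : ℝ} {g : (Fin 1 → ℝ) → ℝ}
    (hd : r.domain = {t | t 0 ∈ Set.Ioo (0:ℝ) 1})
    (hi : EqOn r.integrand (fun t => κ * g t) r.domain) (hg : ∀ t ∈ r.domain, 0 < g t)
    (hv : r.value = 0) : κ = 0 := by
  by_contra hκ
  have hmeas : MeasurableSet r.domain := IntegralRep.measurableSet_domain_holds r
  have hgi : IntegrableOn g r.domain := by
    have h1 : IntegrableOn (fun t => κ⁻¹ * r.integrand t) r.domain := r.integrableOn.const_mul κ⁻¹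
    refine h1.congr_fun (fun t ht => ?_) hmeas
    simp only [hi ht]
    rw [← mul_assoc, inv_mul_cancel₀ hκ, one_mul]
  have hval : r.value = κ * ∫ t in r.domain, g t := by
    unfold IntegralRep.value
    rw [setIntegral_congr_fun hmeas hi, integral_const_mul]
  have hpos : 0 < ∫ t in r.domain, g t := by
    rw [setIntegral_pos_iff_support_of_nonneg_ae
      (ae_restrict_of_forall_mem hmeas fun t ht => (hg t ht).le) hgi]
    have hs : Function.support g ∩ r.domain = r.domain :=
      Set.inter_eq_right.mpr fun t ht => Function.mem_support.mpr (hg t ht).ne'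
    rw [hs, hd]
    exact (isOpen_Ioo.preimage (continuous_apply 0)).measure_pos volume
      ⟨fun _ => 1 / 2, by norm_num⟩
  rw [hval] at hv
  exact mul_ne_zero hκ hpos.ne' hv

/-- The Beta integrand `t^{x−1}(1−t)^{y−1}` is positive on `(0,1)`. [folklore] -/
theorem betaIntegrand_pos (x y : ℚ) {t : Fin 1 → ℝ} (ht : t ∈ {t : Fin 1 → ℝ | t 0 ∈ Set.Ioo (0:ℝ) 1}) :
    0 < (t 0) ^ ((x : ℝ) - 1) * (1 - t 0) ^ ((y : ℝ) - 1) := by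
  have ht' : 0 < t 0 ∧ t 0 < 1 := ht
  exact mul_pos (Real.rpow_pos_of_pos ht'.1 _) (Real.rpow_pos_of_pos (sub_pos.2 ht'.2) _)

/-- The Euler integrand `t^{b−1}(1−t)^{c−b−1}(1−λt)^{−a}` is positive on `(0,1)` for `0 < λ < 1`.
[folklore] -/
theorem eulerIntegrand_pos (a b c : ℚ) {lam : ℝ} (hl0 : 0 < lam) (hl1 : lam < 1) {t : Fin 1 → ℝ}
    (ht : t ∈ {t : Fin 1 → ℝ | t 0 ∈ Set.Ioo (0:ℝ) 1}) :
    0 < (t 0) ^ ((b : ℝ) - 1) * (1 - t 0) ^ ((c : ℝ) - (b : ℝ) - 1) * (1 - lam * t 0) ^ (-(a : ℝ)) := by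
  have ht' : 0 < t 0 ∧ t 0 < 1 := ht
  have h1 : 0 < 1 - lam * t 0 := by nlinarith [ht'.1, ht'.2]
  exact mul_pos (mul_pos (Real.rpow_pos_of_pos ht'.1 _) (Real.rpow_pos_of_pos (sub_pos.2 ht'.2) _))
    (Real.rpow_pos_of_pos h1 _)

/-- **The degenerate edge of the stub is true unconditionally.** If `α = 0` or `β = 0` then, under
the hypotheses of `stub_eulerBetaTransfer`, BOTH coefficients vanish (value equality and positivity
of the two integrands on `(0,1)`, `coeff_eq_zero_of_value_eq_zero`), both integrands vanish on their
domains, and both representations are relations (`KZ.of_mem_relations_of_eqOn_zero`: integrand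
additivity `z = z + z` with a zero representation), so `r ∼ ρ`. In particular the edge `α = 0`
(allowed by `IsAlgebraic ℚ α`) is not a misstatement of the registered signature.
[cite: KontsevichZagier2001, §1.2 rule (1)] -/
theorem stub_eulerBetaTransfer_degenerate :
    ∀ (a b c x y : ℚ) (lam α β : ℝ), α = 0 ∨ β = 0 → Int.fract a ≠ 0 → Int.fract b ≠ 0 →
      Int.fract (c - a) ≠ 0 →
      Int.fract (c - b) ≠ 0 → 0 < b → b < c → a + b ≤ c → 0 < x → 0 < y → Int.fract x ≠ 0 →
      Int.fract y ≠ 0 → 0 < lam → lam < 1 → IsAlgebraic ℚ lam → IsAlgebraic ℚ α → IsAlgebraic ℚ β →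
      ∀ (r ρ : IntegralRep 1), r.domain = {t | t 0 ∈ Set.Ioo (0:ℝ) 1} →
      Set.EqOn r.integrand (fun t => α * (t 0) ^ ((b : ℝ) - 1) * (1 - t 0) ^ ((c : ℝ) - (b : ℝ) - 1) *
        (1 - lam * t 0) ^ (-(a : ℝ))) r.domain →
      ρ.domain = {t | t 0 ∈ Set.Ioo (0:ℝ) 1} →
      Set.EqOn ρ.integrand (fun t => β * (t 0) ^ ((x : ℝ) - 1) * (1 - t 0) ^ ((y : ℝ) - 1)) ρ.domain →
      r.value = ρ.value → Equivalent r ρ := by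
  intro a b c x y lam α β hαβ _ _ _ _ _ _ _ _ _ _ _ hl0 hl1 _ _ _ r ρ hrd hri hρd hρi hv
  -- both coefficients vanish
  have hα : α = 0 := by
    rcases hαβ with h | hβ
    · exact h
    · subst hβ
      have hρv : ρ.value = 0 := value_eq_zero_of_eqOn_zero fun t ht => by simp [hρi ht]
      exact coeff_eq_zero_of_value_eq_zero hrd
        (g := fun t => (t 0) ^ ((b : ℝ) - 1) * (1 - t 0) ^ ((c : ℝ) - (b : ℝ) - 1) *
          (1 - lam * t 0) ^ (-(a : ℝ)))
        (fun t ht => by simp only [hri ht, mul_assoc])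
        (fun t ht => eulerIntegrand_pos a b c hl0 hl1 (hrd ▸ ht)) (hv.trans hρv)
  have hβ : β = 0 := by
    subst hα
    have hrv : r.value = 0 := value_eq_zero_of_eqOn_zero fun t ht => by simp [hri ht]
    exact coeff_eq_zero_of_value_eq_zero hρd
      (g := fun t => (t 0) ^ ((x : ℝ) - 1) * (1 - t 0) ^ ((y : ℝ) - 1))
      (fun t ht => by simp only [hρi ht, mul_assoc])
      (fun t ht => betaIntegrand_pos x y (hρd ▸ ht)) (hv.symm.trans hrv)
  subst hα
  subst hβ
  exact relations.sub_mem (of_mem_relations_of_eqOn_zero r fun t ht => by simp [hri ht])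
    (of_mem_relations_of_eqOn_zero ρ fun t ht => by simp [hρi ht])

end Summit.KontsevichZagierPeriods.KontsevichZagierPeriods.CompleteModGammaSectorLine

end
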